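/-
Copyright (c) 2026 the pub-hodgecm-mathlib formalisation cell (harness21).  Prover seat hodgecm-mathlib-A-p03 (g25); LEAD F0P3a-plan (g9), map of record
WORD T8-122 (3) (A-p03 (g24) 07:01:57Z recipe for X₂∕X₃∕X₄); LAYER C, θ̄ = 1, frame data CONSTRUCTED and the scalar `π` NORMALISED, 2026-09-01.
-/
import Literature.NumberTheory.Rogawski1990.UnitOrbitalIntegralInertValueThetaOneClosed     -- ★ p841664 `…_eq_phiOne_of_bridge` (θ = ϖ^1)
import Literature.NumberTheory.Rogawski1990.UnitOrbitalIntegralInertValueExponents          -- ★ p841930 `exists_exponent_phiOne_eq` (N₊ ↔ Q₁)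
import Literature.NumberTheory.Automorphic.UnitaryThreeTorusBlockElements                   -- ★ `exists_coe_eq_block_of_rel`, `exists_diagRadial`
import Literature.NumberTheory.Automorphic.UnitaryThreeAnisotropicNormalFormExponents       -- ★ B-p14 `natCard_fixedPoints_quotient_conj_eq`
import Literature.NumberTheory.LocalFields.UnramifiedQuadraticNormSurjective                -- ★ Serre V §2 `exists_mul_map_eq_of_finite_residueField`
import Literature.NumberTheory.Automorphic.UnitaryThreeBorelCosetCountJZeroNear               -- ★ `maximalIdeal_integer_eq_span`
import Literature.NumberTheory.Rogawski1990.UnitFundamentalLemmaInertFlickerTorus           -- ★ `diagRadial_mul_flickerTorusElt`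
import HarnessLib

/-!
# The `θ̄ = 1` value with the frame data CONSTRUCTED and Flicker's scalar `π` NORMALISED:
# `#Fix_{U⧸K}(t_π(a,b,c)) = φ₁(N₁, N)` for ANY `σ`-fixed non-norm `π`, from `LocalConjDatum` data alone
(Flicker (1998), *Elementary proof of the fundamental lemma for a unitary group*, Prop. 11 p. 87 (+ Props. 12–13 pp. 89–94 through Prop. 10); Prop. 5 p. 82, Prop. 6 p. 83)

Topic `NumberTheory/Rogawski1990` (road «D-N7-inert», MAP v3 LAYER C → (F12) value stubs `X₂, X₃, X₄` = `stub_splitGValue2∕3∕4` of the line «N7nsCount» ED. 1.5);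
namespace `Literature.NumberTheory.Automorphic.UnitaryGroup`.  THEOREMS ONLY; kernel lane.  HONEST LABEL: HC_CM is proved only modulo the printed citations until
rung 0 closes.

The three type-(1) value stubs with `κ`-sign pattern `θ̄ = 1` read, at the place `w`, a torus literal
`t_π(a, b, c) = !![e(a+c), 0, −e(a−c)π; 0, b, 0; −e(a−c)π′, 0, e(a+c)]` (`2e = 1`, `a, b, c` of norm one, `π π′ = 1`) where Flicker's scalar `π` is ANY
`σ`-fixed element which is not a norm `σ(z) z` (★ `exists_flicker_scalars_of_nonsplit`); the value is `φ₁(Q₁, P)` with `P = ord(a − c)` (the corner pair) and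
`Q₁ = ord(a − b)`.  ★ `natCard_fixedPoints_unitaryInt_flickerTorus_eq_phiOne_of_bridge` (p841664) computes `#Fix = φ₁(N₊, P)` for `θ = ϖ` THE uniformizer of the
local conjugation datum and `N₊ = ord(a + c − 2b)`, taking the frame (`c = diag(1,−1,1)`, the level elements `η_m`, the radial family, an integer frame) as data.
This file closes the gap in three moves, all elementary:
* §1 **`natCard_fixedPoints_unitaryInt_corner_eq_phiOne`** — `θ = ϖ`: the frame data are BUILT exactly as in ★ `…corner_eq_phiZero` (★ `exists_coe_eq_block_of_rel`,
  ★ `exists_coe_eq_flickerU`, ★ `exists_diagRadial`, ★ `mem_centralizer_of_coe_eq_block`, the integer frame at `R := 𝒪[K]`), `N₊` and the dictionary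
  `φ₁(N₊, P) = φ₁(Q₁, P)` come from ★ `exists_exponent_phiOne_eq`, and `1 < q` from `#𝓀 = q²` (a finite field has at least two elements).
* §2 **`exists_valued_eq_exp_two_mul_add_one_of_forall_mul_map_ne`** — a `σ`-fixed NON-NORM `π` has ODD order: were `ord π = 2j`, `π ϖ^{−2j}… ` would be a `σ`-fixed
  UNIT of `𝒪`, hence a norm by Serre's «`U_K = N U_L`» (★ `exists_mul_map_eq_of_finite_residueField`, whose hypothesis «`σ` moves an integer by a unit» is the
  frame's `ha₀`), and then `π` itself would be a norm.  [Serre1979, Ch. V §2 Prop. 3 Cor.; Flicker p. 79 «`Δ ∈ F − NE`»]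
* §3 **`natCard_fixedPoints_unitaryInt_corner_eq_phiOne_of_valued_eq`** — `ord π = 2k+1`: conjugating by the radial unitary `diag(ϖ^{k+1}…)⁻¹`-type element
  `g = diag(u, 1, u⁻¹)`, `u = ϖ^{k+1}` (★ `exists_coe_eq_block_of_rel`; Flicker's `r` of Prop. 6) rescales `π ↦ π u² =: ϖ″` (★ `diagRadial_mul_flickerTorusElt`), a `σ`-fixed
  UNIFORMIZER, so `LocalConjDatum σ ϖ″` holds with the same `σ`-data and §1 applies to `g t g⁻¹`; `#Fix` and its finiteness are conjugation invariant (★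
  `natCard_fixedPoints_quotient_conj_eq`, ★ `finite_fixedPoints_quotient_conj_iff`).  [Flicker Prop. 5 p. 82: the count depends on the class of `t` only]
* §4 **`natCard_fixedPoints_unitaryInt_corner_eq_phiOne_of_forall_mul_map_ne`** — THE HEAD for the three stubs: the literal `t_π(a,b,c)` with the stub's scalar
  hypotheses VERBATIM (`σπ = π`, `π π′ = 1`, `∀ z, σz·z ≠ π`) and the orders in the stub's `exp(−N)` form ⊢ `#Fix = φ₁(Q₁, P)`; X₂ is `(a,b,c) := (α, u, γ)`
  (`φ₁(N₁, N)`), X₃ is `(α, γ, u)` (`φ₁(N, N₁)`), X₄ is `(u, α, γ)` (`φ₁(N₁, N₂)`).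
What the (F12) consumer still supplies at `K = L_w` (exactly as for ★ `…corner_eq_phiZero`): `hJ`, `hd`, `hσO`, `y` (`yσy = −2`), `#𝓀 = q²`, `a₀` with `σa₀ − a₀` a unit
(all ★ at `L_w`: p04's ★ `…ThetaZeroAdicCompletion` lines 80–117), the literal, the three orders, `hfin`.

## References
* [Flicker1998UnitaryFL] Y. Z. Flicker, *Elementary proof of the fundamental lemma for a unitary group*, Canad. J. Math. 50 (1998), 74–98: Prop. 3 p. 79, Prop. 5 p. 82,
  Prop. 6 p. 83, §4 p. 85, Prop. 11 p. 87, Props. 12–13 pp. 89–94.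
* [Serre1979] J.-P. Serre, *Local Fields*, GTM 67 (1979), Ch. V §2 Prop. 3, Corollary, Remark 1.
* [Rogawski1990] J. D. Rogawski, *Automorphic Representations of Unitary Groups in Three Variables* (1990), §4.9 p. 55.
-/

set_option autoImplicit false

open scoped MatrixGroups WithZero Valued
open Matrix

namespace Literature.NumberTheory.Automorphic

namespace UnitaryGroup

open Literature.NumberTheory.Automorphic.HermitianLattice (unitaryInt mem_unitaryInt_iff LocalConjDatum)
open Literature.NumberTheory.Rogawski1990.Flicker1998 (phiOne)
open Literature.NumberTheory.Rogawski1990 (diagRadial_mul_flickerTorusElt diagRadial_mul_diagRadial_inv)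
open IsLocalRing

variable {K : Type*} [Field K] [Valued K ℤᵐ⁰] {ϖ : K} (σ : K →+* K) {J : Matrix (Fin 3) (Fin 3) K}

section ThetaOneCorner

variable [IsDiscreteValuationRing 𝒪[K]] [Finite (ResidueField 𝒪[K])] [IsAdicComplete (maximalIdeal 𝒪[K]) 𝒪[K]]

/-! ## §1 `θ = ϖ`: the frame data constructed -/

set_option synthInstance.maxHeartbeats 200000 in
-- the `H`-action on `H ⧸ (K^{u_m} ∩ H)` (as in ★ (F2))
/-- **`#Fix_{U⧸K}(t_ϖ(a,b,c)) = φ₁(N₁, N)` from the local datum alone** (`θ = ϖ` the uniformizer of the datum; frame elements constructed; `N = ord(a − c)`,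
`N₁ = ord(a − b)`; the exponent `N₊ = ord(a + c − 2b)` of ★ `…_eq_phiOne_of_bridge` eliminated by ★ `exists_exponent_phiOne_eq`).
[cite: Flicker1998UnitaryFL, Prop. 11 p. 87; Props. 12–13 pp. 89–94; Prop. 6 p. 83] -/
theorem natCard_fixedPoints_unitaryInt_corner_eq_phiOne (hJ : J = (StdForm.antidiagonal 3).over K) (hd : LocalConjDatum σ ϖ)
    (hσO : ∀ y : 𝒪[K], (σ.comp 𝒪[K].subtype) y ∈ 𝒪[K]) {y : K} (hy : y * σ y = -2)
    {q : ℕ} (hq : Nat.card (ResidueField 𝒪[K]) = q ^ 2)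
    {a₀ : 𝒪[K]} (ha₀ : IsUnit (((σ.comp 𝒪[K].subtype).codRestrict 𝒪[K] hσO) a₀ - a₀))
    {e a b cc : K} (h2e : 2 * e = 1) (ha : σ a * a = 1) (hb : σ b * b = 1) (hcc : σ cc * cc = 1)
    {t : ↥(unitaryGroupOfForm σ J)}
    (hte : ((t : GL (Fin 3) K) : Matrix (Fin 3) (Fin 3) K) =
      !![e * (a + cc), 0, -(e * (a - cc) * ϖ); 0, b, 0; -(e * (a - cc) * ϖ⁻¹), 0, e * (a + cc)])
    {N N₁ N₂ : ℕ} (hN : Valued.v (a - cc) = Valued.v (ϖ ^ N)) (hN₁ : Valued.v (a - b) = Valued.v (ϖ ^ N₁))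
    (hN₂ : Valued.v (cc - b) = Valued.v (ϖ ^ N₂))
    (hfin : {x : ↥(unitaryGroupOfForm σ J) ⧸ unitaryInt σ J | t • x = x}.Finite) :
    (Nat.card {x : ↥(unitaryGroupOfForm σ J) ⧸ unitaryInt σ J | t • x = x} : ℚ) = phiOne q N₁ N := by
  classical
  have hϖ0 : ϖ ≠ 0 := hd.ϖ_ne_zero
  have hac : a ≠ cc := by
    intro h; rw [h, sub_self, map_zero] at hN; exact pow_ne_zero _ hϖ0 ((map_eq_zero _).1 hN.symm)
  -- `c = diag(1, −1, 1)`
  obtain ⟨c, hc⟩ := exists_coe_eq_block_of_rel σ hJ (α := 1) (β := 0) (γ := 0) (δ := 1) (e := -1)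
    (by rw [map_one, map_zero]; ring) (by rw [map_one, map_zero]; ring) (by rw [map_zero, map_one]; ring) (by rw [map_zero, map_one]; ring)
    (by rw [map_neg, map_one]; ring)
  have htH : t ∈ Subgroup.centralizer ({c} : Set ↥(unitaryGroupOfForm σ J)) := mem_centralizer_of_coe_eq_block σ hc hte
  -- the level elements `η_m` and the radial family
  have hu := fun m => exists_coe_eq_flickerU σ hJ hd hy m
  choose u hum using hu
  obtain ⟨r, hr⟩ := exists_diagRadial σ hJ hd.σϖ hϖ0 hc
  -- the integer frame at `R := 𝒪[K]`
  set σO : 𝒪[K] →+* 𝒪[K] := (σ.comp 𝒪[K].subtype).codRestrict 𝒪[K] hσO with hσOdef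
  have hσOσO : ∀ z, σO (σO z) = z := fun z => Subtype.ext (hd.σσ (z : K))
  have hιv : ∀ x : K, Valued.v x ≤ 1 ↔ x ∈ Set.range (𝒪[K].subtype) :=
    fun x => ⟨fun hx => ⟨⟨x, hx⟩, rfl⟩, by rintro ⟨z, rfl⟩; exact z.2⟩
  have hσι : ∀ z : 𝒪[K], 𝒪[K].subtype (σO z) = σ (𝒪[K].subtype z) := fun z => rfl
  have hdRσ : σO (σO a₀ - a₀) = -(σO a₀ - a₀) := by rw [map_sub, hσOσO]; ring
  have h2O : IsUnit (2 : 𝒪[K]) :=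
    (Valuation.Integers.isUnit_iff_valuation_eq_one (Valuation.integer.integers _)).2 (by rw [map_ofNat]; exact hd.v2)
  have hϖle : Valued.v ϖ ≤ 1 := by rw [hd.vϖ, ← WithZero.exp_zero]; exact WithZero.exp_le_exp.2 (by norm_num)
  have hp : Irreducible (⟨ϖ, hϖle⟩ : 𝒪[K]) := (IsDiscreteValuationRing.irreducible_iff_uniformizer _).2 (maximalIdeal_integer_eq_span hd.vϖ)
  -- `1 < q`: the residue field is a finite field
  have hq1 : 1 < q := by
    have h1 : 1 < Nat.card (ResidueField 𝒪[K]) := Finite.one_lt_card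
    rw [hq] at h1
    exact (Nat.one_lt_pow_iff two_ne_zero).1 h1
  -- `N₊` and the dictionary `φ₁(N₊, N) = φ₁(N₁, N)`
  obtain ⟨Np, hNp, hφ⟩ := exists_exponent_phiOne_eq σ hd ha hb hcc hac hN hN₁ hN₂
  rw [← hφ q]
  exact natCard_fixedPoints_unitaryInt_flickerTorus_eq_phiOne_of_bridge σ hJ hd hσO hy hc u hum 𝒪[K].subtype Subtype.val_injective hιv σO hσOσO hσι
    hdRσ ha₀ h2O hp rfl h2e (θ := ϖ) (θ' := ϖ⁻¹) (by rw [pow_one]) (by rw [pow_one]) ha hb hcc hte htH r hr hN hNp hq hq hq1 ha₀ hfin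

/-! ## §2 A `σ`-fixed non-norm has odd order -/

/-- **A `σ`-fixed element which is not a norm `σ(z)·z` has ODD valuation** (`E∕F` unramified: `U_F = N U_E`, so the norms from `Eˣ` are exactly the elements of
even order).  Here: `σ` an isometric involution fixing the uniformizer `ϖ` (`LocalConjDatum`), preserving `𝒪` and moving some integer by a unit (`ha₀`), `𝒪` complete
with finite residue field. [cite: Serre1979, Ch. V §2 Prop. 3, Corollary and Remark 1] [cite: Flicker1998UnitaryFL, Prop. 3 p. 79] -/
theorem exists_valued_eq_exp_two_mul_add_one_of_forall_mul_map_ne (hd : LocalConjDatum σ ϖ)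
    (hσO : ∀ y : 𝒪[K], (σ.comp 𝒪[K].subtype) y ∈ 𝒪[K])
    {a₀ : 𝒪[K]} (ha₀ : IsUnit (((σ.comp 𝒪[K].subtype).codRestrict 𝒪[K] hσO) a₀ - a₀))
    {π : K} (hσπ : σ π = π) (hπN : ∀ z : K, σ z * z ≠ π) :
    ∃ k : ℤ, Valued.v π = WithZero.exp (2 * k + 1) := by
  have hϖ0 : ϖ ≠ 0 := hd.ϖ_ne_zero
  have hπ0 : π ≠ 0 := fun h => hπN 0 (by rw [map_zero, mul_zero, h])
  obtain ⟨m, hm⟩ : ∃ m : ℤ, Valued.v π = WithZero.exp m := ⟨_, (WithZero.exp_log ((Valuation.ne_zero_iff _).2 hπ0)).symm⟩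
  rcases Int.even_or_odd' m with ⟨j, hj | hj⟩
  · -- even order `m = 2j`: `w := π ϖ^{j}·ϖ^{j}` is a `σ`-fixed unit, hence a norm — contradiction
    exfalso
    have hvϖj : Valued.v (ϖ ^ j) = WithZero.exp (-j) := by
      rw [map_zpow₀, hd.vϖ, ← WithZero.exp_zsmul]; congr 1; ring
    have hσϖj : σ (ϖ ^ j) = ϖ ^ j := by rw [map_zpow₀, hd.σϖ]
    set w : K := π * (ϖ ^ j * ϖ ^ j) with hwdef
    have hvw : Valued.v w = 1 := by
      rw [hwdef, map_mul, map_mul, hm, hvϖj, ← WithZero.exp_add, ← WithZero.exp_add, hj, ← WithZero.exp_zero]; congr 1; ring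
    have hσw : σ w = w := by rw [hwdef, map_mul, map_mul, hσπ, hσϖj]
    set σO : 𝒪[K] →+* 𝒪[K] := (σ.comp 𝒪[K].subtype).codRestrict 𝒪[K] hσO with hσOdef
    have hσOσO : ∀ z, σO (σO z) = z := fun z => Subtype.ext (hd.σσ (z : K))
    let wO : 𝒪[K] := ⟨w, hvw.le⟩
    have hwOu : IsUnit wO := (Valuation.Integers.isUnit_iff_valuation_eq_one (Valuation.integer.integers _)).2 hvw
    have hσwO : σO wO = wO := Subtype.ext hσw
    obtain ⟨s, hs⟩ := Literature.NumberTheory.LocalFields.UnramifiedQuadraticNorm.exists_mul_map_eq_of_finite_residueField σO hσOσO ha₀ wO hwOu hσwO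
    have hs' : (s : K) * σ (s : K) = w := by
      have := congrArg Subtype.val hs; simpa [hσOdef] using this
    -- `π = (s ϖ^{−j}) · σ(s ϖ^{−j})`
    have hϖj0 : ϖ ^ j ≠ 0 := zpow_ne_zero _ hϖ0
    refine hπN ((s : K) * (ϖ ^ j)⁻¹) ?_
    rw [map_mul, map_inv₀, hσϖj]
    have : π = w * ((ϖ ^ j)⁻¹ * (ϖ ^ j)⁻¹) := by
      rw [hwdef]; field_simp
    rw [this, ← hs']; ring
  · exact ⟨j, by rw [hm, hj]⟩

/-! ## §3 `ord π` odd: the radial normalisation `π ↦ π u²`, `u = ϖ^{k+1}` -/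

set_option synthInstance.maxHeartbeats 200000 in
-- the `H`-action on `H ⧸ (K^{u_m} ∩ H)` (as in ★ (F2))
/-- **`#Fix_{U⧸K}(t_π(a,b,c)) = φ₁(N₁, N)` for `π` `σ`-fixed of ODD order `ord π = −(2k+1)`-free form `|π| = exp(2k+1)`** (`π π′ = 1`): conjugation by the radial
unitary `g = diag(u, 1, u⁻¹)`, `u = ϖ^{k+1}`, carries `t_π` to `t_{ϖ″}` with `ϖ″ = π u²` a `σ`-fixed UNIFORMIZER, to which §1 applies with the datum
`LocalConjDatum σ ϖ″`; the count and its finiteness are conjugation invariant. [cite: Flicker1998UnitaryFL, Prop. 5 p. 82; Prop. 6 p. 83; Prop. 11 p. 87] -/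
theorem natCard_fixedPoints_unitaryInt_corner_eq_phiOne_of_valued_eq (hJ : J = (StdForm.antidiagonal 3).over K) (hd : LocalConjDatum σ ϖ)
    (hσO : ∀ y : 𝒪[K], (σ.comp 𝒪[K].subtype) y ∈ 𝒪[K]) {y : K} (hy : y * σ y = -2)
    {q : ℕ} (hq : Nat.card (ResidueField 𝒪[K]) = q ^ 2)
    {a₀ : 𝒪[K]} (ha₀ : IsUnit (((σ.comp 𝒪[K].subtype).codRestrict 𝒪[K] hσO) a₀ - a₀))
    {e a b cc π π' : K} (h2e : 2 * e = 1) (ha : σ a * a = 1) (hb : σ b * b = 1) (hcc : σ cc * cc = 1)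
    (hσπ : σ π = π) (hππ' : π * π' = 1) {k : ℤ} (hπ : Valued.v π = WithZero.exp (2 * k + 1))
    {t : ↥(unitaryGroupOfForm σ J)}
    (hte : ((t : GL (Fin 3) K) : Matrix (Fin 3) (Fin 3) K) =
      !![e * (a + cc), 0, -(e * (a - cc) * π); 0, b, 0; -(e * (a - cc) * π'), 0, e * (a + cc)])
    {N N₁ N₂ : ℕ} (hN : Valued.v (a - cc) = WithZero.exp (-(N : ℤ))) (hN₁ : Valued.v (a - b) = WithZero.exp (-(N₁ : ℤ)))
    (hN₂ : Valued.v (cc - b) = WithZero.exp (-(N₂ : ℤ)))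
    (hfin : {x : ↥(unitaryGroupOfForm σ J) ⧸ unitaryInt σ J | t • x = x}.Finite) :
    (Nat.card {x : ↥(unitaryGroupOfForm σ J) ⧸ unitaryInt σ J | t • x = x} : ℚ) = phiOne q N₁ N := by
  classical
  have hϖ0 : ϖ ≠ 0 := hd.ϖ_ne_zero
  have hπ0 : π ≠ 0 := fun h => by rw [h, zero_mul] at hππ'; exact zero_ne_one hππ'
  have hπ' : π' = π⁻¹ := eq_inv_of_mul_eq_one_right hππ'
  -- the radial scalar `u = ϖ^{k+1}`
  set uu : K := ϖ ^ (k + 1) with huudef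
  have huu0 : uu ≠ 0 := zpow_ne_zero _ hϖ0
  have hσuu : σ uu = uu := by rw [huudef, map_zpow₀, hd.σϖ]
  have hvuu : Valued.v uu = WithZero.exp (-(k + 1)) := by
    rw [huudef, map_zpow₀, hd.vϖ, ← WithZero.exp_zsmul]; congr 1; ring
  -- the normalised uniformizer `ϖ″ = π u²`
  set ϖ'' : K := π * uu * uu with hϖ''def
  have hσϖ'' : σ ϖ'' = ϖ'' := by rw [hϖ''def, map_mul, map_mul, hσπ, hσuu]
  have hvϖ'' : Valued.v ϖ'' = WithZero.exp (-1 : ℤ) := by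
    rw [hϖ''def, map_mul, map_mul, hπ, hvuu, ← WithZero.exp_add, ← WithZero.exp_add]; congr 1; ring
  have hd'' : LocalConjDatum σ ϖ'' := ⟨hd.σσ, hd.vσ, hσϖ'', hvϖ'', hd.v2, hd.sqrt⟩
  -- the radial unitary `g = diag(u, 1, u⁻¹)`
  obtain ⟨g, hg⟩ := exists_coe_eq_block_of_rel σ hJ (α := uu) (β := 0) (γ := 0) (δ := uu⁻¹) (e := 1)
    (by rw [map_zero]; ring) (by rw [hσuu, map_zero, mul_inv_cancel₀ huu0]; ring) (by rw [map_zero, map_inv₀, hσuu, inv_mul_cancel₀ huu0]; ring)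
    (by rw [map_zero, map_inv₀, hσuu]; ring) (by rw [map_one, mul_one])
  -- `g t g⁻¹ = t_{ϖ″}`
  have hconj : (((g * t * g⁻¹ : ↥(unitaryGroupOfForm σ J)) : GL (Fin 3) K) : Matrix (Fin 3) (Fin 3) K) =
      !![e * (a + cc), 0, -(e * (a - cc) * ϖ''); 0, b, 0; -(e * (a - cc) * ϖ''⁻¹), 0, e * (a + cc)] := by
    have hmul := diagRadial_mul_flickerTorusElt (e := e) (θ := π) (θ' := π') (a := a) (b := b) (c := cc) (mul_inv_cancel₀ huu0)
    have hθ'' : π' * uu⁻¹ * uu⁻¹ = ϖ''⁻¹ := by rw [hϖ''def, hπ', mul_inv, mul_inv]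
    rw [show π * uu * uu = ϖ'' from rfl, hθ''] at hmul
    have hginv : (((g⁻¹ : ↥(unitaryGroupOfForm σ J)) : GL (Fin 3) K) : Matrix (Fin 3) (Fin 3) K) = !![uu⁻¹, 0, 0; 0, 1, 0; 0, 0, uu] := by
      rw [Subgroup.coe_inv, Matrix.coe_units_inv, hg]
      exact Matrix.inv_eq_left_inv (diagRadial_mul_diagRadial_inv (inv_mul_cancel₀ huu0))
    rw [Subgroup.coe_mul, Subgroup.coe_mul, Units.val_mul, Units.val_mul, hg, hte, hmul, hginv, Matrix.mul_assoc,
      diagRadial_mul_diagRadial_inv (mul_inv_cancel₀ huu0), Matrix.mul_one]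
  -- conjugation invariance of the count and of its finiteness (`g t g⁻¹ = (g⁻¹)⁻¹ t g⁻¹`)
  have hgtg : (g⁻¹)⁻¹ * t * g⁻¹ = g * t * g⁻¹ := by rw [inv_inv]
  have hcard := natCard_fixedPoints_quotient_conj_eq σ (unitaryInt σ J) g⁻¹ t
  have hfin' : {x : ↥(unitaryGroupOfForm σ J) ⧸ unitaryInt σ J | (g * t * g⁻¹) • x = x}.Finite := by
    rw [← hgtg]; exact (finite_fixedPoints_quotient_conj_iff σ (unitaryInt σ J) g⁻¹ t).2 hfin
  rw [hgtg] at hcard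
  rw [← hcard]
  -- §1 at the datum `ϖ″`
  exact natCard_fixedPoints_unitaryInt_corner_eq_phiOne σ hJ hd'' hσO hy hq ha₀ h2e ha hb hcc hconj
    (by rw [hN, hd''.v_pow]) (by rw [hN₁, hd''.v_pow]) (by rw [hN₂, hd''.v_pow]) hfin'

/-! ## §4 The head for the stubs: Flicker's scalar hypotheses verbatim -/

set_option synthInstance.maxHeartbeats 200000 in
-- the `H`-action on `H ⧸ (K^{u_m} ∩ H)` (as in ★ (F2))
/-- **LAYER C, `θ̄ = 1`, frame and scalar discharged: `#Fix_{U⧸K}(t_π(a,b,c)) = φ₁(N₁, N)`** for Flicker's scalar `π` as the stubs carry it — `σ`-fixed,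
`π π′ = 1`, NOT a norm `σ(z)·z` — and the orders `|a − c| = q^{−N}`, `|a − b| = q^{−N₁}`, `|c − b| = q^{−N₂}` in `exp` form (§2: `ord π` is odd; §3).  Serves
X₂ with `(a,b,c) = (α, u, γ)`, X₃ with `(α, γ, u)`, X₄ with `(u, α, γ)`. [cite: Flicker1998UnitaryFL, Prop. 3 p. 79; Prop. 5 p. 82; Prop. 11 p. 87; Props. 12–13 pp. 89–94] -/
theorem natCard_fixedPoints_unitaryInt_corner_eq_phiOne_of_forall_mul_map_ne (hJ : J = (StdForm.antidiagonal 3).over K) (hd : LocalConjDatum σ ϖ)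
    (hσO : ∀ y : 𝒪[K], (σ.comp 𝒪[K].subtype) y ∈ 𝒪[K]) {y : K} (hy : y * σ y = -2)
    {q : ℕ} (hq : Nat.card (ResidueField 𝒪[K]) = q ^ 2)
    {a₀ : 𝒪[K]} (ha₀ : IsUnit (((σ.comp 𝒪[K].subtype).codRestrict 𝒪[K] hσO) a₀ - a₀))
    {e a b cc π π' : K} (h2e : 2 * e = 1) (ha : σ a * a = 1) (hb : σ b * b = 1) (hcc : σ cc * cc = 1)
    (hσπ : σ π = π) (hππ' : π * π' = 1) (hπN : ∀ z : K, σ z * z ≠ π)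
    {t : ↥(unitaryGroupOfForm σ J)}
    (hte : ((t : GL (Fin 3) K) : Matrix (Fin 3) (Fin 3) K) =
      !![e * (a + cc), 0, -(e * (a - cc) * π); 0, b, 0; -(e * (a - cc) * π'), 0, e * (a + cc)])
    {N N₁ N₂ : ℕ} (hN : Valued.v (a - cc) = WithZero.exp (-(N : ℤ))) (hN₁ : Valued.v (a - b) = WithZero.exp (-(N₁ : ℤ)))
    (hN₂ : Valued.v (cc - b) = WithZero.exp (-(N₂ : ℤ)))
    (hfin : {x : ↥(unitaryGroupOfForm σ J) ⧸ unitaryInt σ J | t • x = x}.Finite) :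
    (Nat.card {x : ↥(unitaryGroupOfForm σ J) ⧸ unitaryInt σ J | t • x = x} : ℚ) = phiOne q N₁ N := by
  obtain ⟨k, hk⟩ := exists_valued_eq_exp_two_mul_add_one_of_forall_mul_map_ne σ hd hσO ha₀ hσπ hπN
  exact natCard_fixedPoints_unitaryInt_corner_eq_phiOne_of_valued_eq σ hJ hd hσO hy hq ha₀ h2e ha hb hcc hσπ hππ' hk hte hN hN₁ hN₂ hfin

end ThetaOneCorner

end UnitaryGroup

end Literature.NumberTheory.Automorphic
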